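import Literature.MathematicalPhysics.QuantumFieldTheory.Balaban1983to89.B9Thm31NearFlatCoerciveCubeZd
import Literature.MathematicalPhysics.QuantumFieldTheory.Balaban1983to89.B9Thm31NearFlatTransportersZd

/-!
# `Balaban1983to89.B9Thm31NearFlatCoerciveClassZd` — [Balaban1985BackgroundPropagators] Thm 3.1 p. 397 ∕ Thm 3.11 p. 416 with [Balaban1984PropagatorsII] (2.22) p. 226 and
# [Balaban1985Averaging] Prop. 2 (52)–(54) p. 26: THE MEMBER-UNIFORM COERCIVITY OF `□₀Δ′_a(U₀)□₀` AT EVERY CUBE MEMBER OF [Balaban1985RegularSpaces] (1.131) FOR EVERY UNITARY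
# BACKGROUND IN THE BOND-SMALL, PLAQUETTE-SMALL CLASS — `‖U₀(b) − 1‖ ≤ θ′η` on all bonds, `pdev U₀ < α₀L^{−2k}` — with a constant
# `a₀∕2 − (2C_uC_l)²(dθ′² + Ad²L²(256(d+1)(d+4)α₀ + θ′)²)` free of `η`, `m`, `M` and the member: the knot of this seat's flat block-Poincaré coercivity, near-flat form comparison,
# and tower-transporter bounds

statement-level skeleton of published theorems with citation tags; proofs where landed; nothing here is a claim about the
Yang–Mills mass gap

`[Balaban1985BackgroundPropagators]` ("B9", CMP **99** (1985) 389–434) Thm 3.1 p. 397, Thm 3.11 p. 416 («Δ′_a, G′ … positive definite … we get the configuration U = e^{iηA} with A small …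
G_□(1) is positive, hence by the same reasoning as above we prove positivity»), (3.23)–(3.24) p. 394; `[Balaban1984PropagatorsII]` (2.22) p. 226; `[Balaban1985Averaging]` Prop. 2
(52)–(54) p. 26; `[Balaban1985RegularSpaces]` (1.131) p. 99.  PDF held: `paper:balaban1985-cmp99-background-propagators` p. 416 (re-read 2026-08-28).

CITATION HEADER (lean-in-tree rule).  Cell `pub-ymgap` (YM Track A, D-0062 ∕ D-0149), node N06 = [B9], width seat `pub-ymgap-dag-n06-w4` (g5), CLAIM-9 ∕ INTENT-9 — inputs BY NAME: this seat's
`B9Thm31NearFlatCoerciveCubeZd.coercive_near_flat_cubeMember_of_norm` (CLAIM-7) and `B9Thm31NearFlatTransportersZd` (CLAIM-8: `norm_bgT_pair_sub_one_le`, `bgT_mem_unitaryUnits_of_pdev`,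
`sum_eps_sq_weight_le`); dag-n06-b's norm-comparison constants (`exists_fnorm_cmp` shape).

WHAT IS PROVED (kernel, 0 sorry; theorems only).
* ★★★ `coercive_near_flat_cubeMember_of_class` — at every cube member (`L ≤ ρ`, `m ≤ k`), for every unitary `U₀` with `‖U₀(b) − 1‖ ≤ θ′η` and `pdev U₀ < α₀L^{−2k}`
  (`C₀α₀ ≤ ⅓`, `2α₀ ≤ c₂′`, `L ≥ 2`), `L^{−k} ≤ η`, `ηLʲ ≤ 1` (`j ≤ m`), weights `a₀(Lʲ)^d ≤ a_jη²(Lʲ)² ≤ A(Lʲ)^d` (`a₀ ≤ 8`), norm-comparison constants `C_u, C_l` of `|·|_τ`: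
  `(a₀∕2 − (2C_uC_l)²(dθ′² + Ad²L²(256(d+1)(d+4)α₀ + θ′)²))·⟨f, f⟩_τ ≤ ⟨f, □₀Δ′_a(U₀)□₀ f⟩_τ` for every `f ∈ L²(□₀, ·)`.
* `coercive_one_cubeMember_of_class` (A6: the flat background lies in the class, `θ′ = 0`).
* ★★★ `weighted_coercive_near_flat_cubeMember_of_class` — THE LEVEL-MASS EDITION: any weighted FLAT coercivity `Σ_{z∈□₀} M(z)|g(z)|²_τ ≤ ⟨g, □₀Δ′_a(1)□₀ g⟩_τ` with
  `M ≥ M₀ > 0` on `□₀` (print's level masses `min{8(ηL^{j(z)})⁻², a_{j(z)}(Lᵈ)^{−j(z)}}` of [Balaban1984PropagatorsII] (2.27) are the intended instance — the flat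
  weighted theorem is a sibling's file, taken here as the hypothesis `hflat`) transfers to every `U₀` of the class:
  `(1∕2 − (2C_uC_l)²(dθ′² + Ad²L²(256(d+1)(d+4)α₀ + θ′)²)∕M₀)·Σ M|f|²_τ ≤ ⟨f, □₀Δ′_a(U₀)□₀ f⟩_τ` — the `hco` of the Agmon road with an `η`-free window.

HONEST SCOPE.  The class is print's small field in a REGULAR GAUGE — `U = e^{iηA}` with `|A| ≤ θ′` is exactly what [Balaban1985RegularSpaces]'s gauge fixing (node N05 of this
cell) delivers from the plaquette class (3.35); that gauge fixing and the gauge covariance of the form are NOT here (an axial gauge on `□₀` alone only gives `‖U − 1‖ ≤ O(M²α₀)`,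
not `O(η)`); constants explicit, crude, member-uniform; `L²_τ` currency, no decay; count-neutral helper (`--supports` the K1 item
of record); N05 ∕ N06 NOT discharged; K1 NOT closed; one finite `𝕋⁴` programme at fixed `ε`, Bałaban as printed; R4 closes only the conditional finite-`𝕋⁴` rung `BalabanLadder.UV`
— nothing continuum ∕ ℝ⁴ ∕ OS ∕ mass gap ∕ Clay.  Unit `pub-ymgap-dag-n06-w4` (g5), 2026-08-28.
-/

noncomputable section

namespace Literature.MathematicalPhysics.QuantumFieldTheory.Balaban1983to89.B9Thm31NearFlatCoerciveClassZd

open B7Prop1Explicit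
open B7Prop2Explicit (unitaryUnits pdev C0 c2')
open B8Eq131CubesAdmissible (cubeFam)
open B8CubeMemberZd (cubeLamS)
open B8LeafModelZd (ZdIdx)
open B8Eq191FlatLettersCubeMember (cubeLamS_finite)
open B9Eq321LandauProjectionZd (suppSub formE)
open B9Eq324DeltaPrimeAZd (deltaPrimeADom)
open B9Eq342CombesThomasFormZd (fnorm)
open B9Thm311PosDefOpenZd (cubeMember_Ω0_finite)
open B9Thm31NearFlatCoerciveCubeZd (coercive_near_flat_cubeMember_of_norm fnorm_conjR_sub_le_of_cmp)
open B9Eq324NearFlatFormComparisonZdTowerPairs (formE_deltaPrimeADom_one_le_near_flat')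
open B9Thm31NearFlatTransportersZd (norm_bgT_pair_sub_one_le bgT_mem_unitaryUnits_of_pdev sum_eps_sq_weight_le)

-- `Site` alone could resolve to the torus sites of `Setup.lean`; re-export the `ℤ^d` sites of `B7Prop1Explicit`.
export B7Prop1Explicit (Site)

variable {d : ℕ} {𝔸 : Type*} [CStarAlgebra 𝔸] [FiniteDimensional ℝ 𝔸] [Nontrivial 𝔸]
variable (τ : 𝔸 →ₗ[ℂ] ℂ) (hτp : ∀ a : 𝔸, a ≠ 0 → 0 < (τ (star a * a)).re)
  (hτt : ∀ a b : 𝔸, τ (a * b) = τ (b * a)) (hτs : ∀ a : 𝔸, τ (star a) = starRingEnd ℂ (τ a))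
variable {L : ℕ} [NeZero L] {η : ℝ} {U₀ : Site d → Fin d → 𝔸ˣ}

include hτt hτs in
/-- ★★★ **THE MEMBER-UNIFORM COERCIVITY OF `□₀Δ′_a(U₀)□₀` ON THE BOND-SMALL, PLAQUETTE-SMALL CLASS, AT EVERY CUBE MEMBER** — see the module docstring for the list of hypotheses;
the constant `a₀∕2 − (2C_uC_l)²(dθ′² + Ad²L²(256(d+1)(d+4)α₀ + θ′)²)` depends on nothing but `d, L, a₀, A, θ′, α₀` and the norm-comparison constants of the fibre.
[cite: Balaban1985BackgroundPropagators, Thm 3.1 p.397, Thm 3.11 p.416, (3.23)–(3.24) p.394; Balaban1984PropagatorsII, (2.22) p.226; Balaban1985Averaging, Prop. 2 (52)–(54) p.26; Balaban1985RegularSpaces, (1.131) p.99] -/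
theorem coercive_near_flat_cubeMember_of_class {Cu Cl : ℝ} (hCu : ∀ a : 𝔸, fnorm τ a ≤ Cu * ‖a‖) (hCl : ∀ a : 𝔸, ‖a‖ ≤ Cl * fnorm τ a)
    (hCu0 : 0 ≤ Cu) (hCl0 : 0 ≤ Cl) (hL : 2 ≤ L) (hη : 0 < η) {a₁ : ℕ → ℝ} (ha : ∀ j, 0 ≤ a₁ j)
    (i : ZdIdx d L) {a : Site d} {Mc ρ : ℕ} (hΩ : i.Ω = cubeFam false L a Mc ρ i.k) (hρ : L ≤ ρ) {m : ℕ} (hm : m ≤ i.k)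
    (hkη : ((L : ℝ) ^ i.k)⁻¹ ≤ η) (hηL : ∀ j ∈ Finset.range (m + 1), η * (L : ℝ) ^ j ≤ 1)
    {a₀ A : ℝ} (ha₀8 : a₀ ≤ 8) (ha₀ : ∀ j ∈ Finset.range (m + 1), a₀ * ((L : ℝ) ^ j) ^ d ≤ a₁ j * η ^ 2 * ((L : ℝ) ^ j) ^ 2)
    (haA : ∀ j ∈ Finset.range (m + 1), a₁ j * η ^ 2 * ((L : ℝ) ^ j) ^ 2 ≤ A * ((L : ℝ) ^ j) ^ d)
    (hU : ∀ (x : Site d) (κ' : Fin d), U₀ x κ' ∈ unitaryUnits 𝔸)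
    {θ' : ℝ} (hθ' : 0 ≤ θ') (hR : ∀ (x : Site d) (μ : Fin d), ‖((U₀ x μ : 𝔸ˣ) : 𝔸) - 1‖ ≤ θ' * η)
    {α₀ : ℝ} (hα : 0 < α₀) (hα3 : C0 d * α₀ ≤ 1 / 3) (hα2 : 2 * α₀ ≤ c2' d L) (h52 : pdev U₀ < α₀ * (((L : ℝ) ^ i.k)⁻¹) ^ 2)
    (f : suppSub (𝔸 := 𝔸) (cubeMember_Ω0_finite i hΩ).toFinset) :
    (a₀ / 2 - (2 * Cu * Cl) ^ 2 * (d * θ' ^ 2 + A * d ^ 2 * (L : ℝ) ^ 2 * (256 * (d + 1) * (d + 4) * α₀ + θ') ^ 2)) *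
        formE τ (cubeMember_Ω0_finite i hΩ).toFinset f f ≤
      formE τ (cubeMember_Ω0_finite i hΩ).toFinset f
        (deltaPrimeADom L U₀ η τ hτp m a₁ (fun j => (cubeLamS_finite L a Mc ρ i.k m j).toFinset) (cubeMember_Ω0_finite i hΩ).toFinset f) := by
  have hδ0 : 0 ≤ θ' * η := mul_nonneg hθ' hη.le
  -- the tower transporters of the class: unitary, and `ε′_i`-close to `1` on the tower pairs
  have hT : ∀ i', i' < m → ∀ z y : Site d, B8Eq119TwistedAxial.bgT L U₀ i' z y ∈ unitaryUnits 𝔸 :=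
    fun i' hi' z y => bgT_mem_unitaryUnits_of_pdev hL i.k hU hα hα3 hα2 h52 (by omega) z y
  have hTε : ∀ i', i' < m → ∀ (w : Site d),
      ‖((B8Eq119TwistedAxial.bgT L U₀ i' (Literature.MathematicalPhysics.QuantumLattice.blockMap L w) w : 𝔸ˣ) : 𝔸) - 1‖ ≤
        d * L * (256 * (d + 1) * (d + 4) * α₀ * ((L : ℝ) ^ i' * ((L : ℝ) ^ i.k)⁻¹) ^ 2 + (L : ℝ) ^ i' * (θ' * η)) :=
    fun i' hi' w => norm_bgT_pair_sub_one_le hL i.k hU hα hα3 hα2 h52 hδ0 hR (by omega) w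
  have hε' : ∀ i' : ℕ, 0 ≤ d * L * (256 * (d + 1) * (d + 4) * α₀ * ((L : ℝ) ^ i' * ((L : ℝ) ^ i.k)⁻¹) ^ 2 + (L : ℝ) ^ i' * (θ' * η)) :=
    fun i' => by positivity
  have hκ0 : 0 ≤ A * d ^ 2 * (L : ℝ) ^ 2 * (256 * (d + 1) * (d + 4) * α₀ + θ') ^ 2 := by
    have hA : 0 ≤ A := by
      -- from the upper weight bound at `j = 0`: `0 ≤ a₀·η²·1 ≤ A·1`
      have h0 : (0 : ℕ) ∈ Finset.range (m + 1) := Finset.mem_range.2 (Nat.succ_pos m)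
      have h2 := haA 0 h0
      have h3 : 0 ≤ a₁ 0 * η ^ 2 * ((L : ℝ) ^ 0) ^ 2 := mul_nonneg (mul_nonneg (ha 0) (sq_nonneg η)) (sq_nonneg _)
      rw [pow_zero, one_pow, mul_one, one_pow, mul_one] at h2
      rw [pow_zero, one_pow, mul_one] at h3
      exact h3.trans h2
    positivity
  exact coercive_near_flat_cubeMember_of_norm τ hτp hτt hτs hCu hCl hCu0 hCl0 hη ha i hΩ hρ hm hηL ha₀8 ha₀ hU hR hε' hT hTε hκ0
    (fun j hj => sum_eps_sq_weight_le hL hη hkη hηL hθ' hα.le ha haA hj) f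


include hτt hτs in
/-- **A6 ∕ NON-VACUITY — THE FLAT BACKGROUND IS IN THE CLASS**: at `U₀ = 1` (`pdev 1 = 0`, `‖1 − 1‖ = 0 ≤ 0·η`) the theorem applies with `θ′ = 0` for every admissible `α₀`:
`(a₀∕2 − (2C_uC_l)²·Ad²L²(256(d+1)(d+4)α₀)²)·⟨f, f⟩_τ ≤ ⟨f, □₀Δ′_a(1)□₀ f⟩_τ` (as `α₀ ↓ 0` the constant tends to `a₀∕2`, half the flat one of `B9Thm31FlatPoincareCoerciveZd`).
[cite: Balaban1985BackgroundPropagators, Thm 3.11 p.416; Balaban1984PropagatorsII, (2.22) p.226; Balaban1985RegularSpaces, (1.131) p.99] -/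
theorem coercive_one_cubeMember_of_class {Cu Cl : ℝ} (hCu : ∀ a : 𝔸, fnorm τ a ≤ Cu * ‖a‖) (hCl : ∀ a : 𝔸, ‖a‖ ≤ Cl * fnorm τ a)
    (hCu0 : 0 ≤ Cu) (hCl0 : 0 ≤ Cl) (hL : 2 ≤ L) (hη : 0 < η) {a₁ : ℕ → ℝ} (ha : ∀ j, 0 ≤ a₁ j)
    (i : ZdIdx d L) {a : Site d} {Mc ρ : ℕ} (hΩ : i.Ω = cubeFam false L a Mc ρ i.k) (hρ : L ≤ ρ) {m : ℕ} (hm : m ≤ i.k)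
    (hkη : ((L : ℝ) ^ i.k)⁻¹ ≤ η) (hηL : ∀ j ∈ Finset.range (m + 1), η * (L : ℝ) ^ j ≤ 1)
    {a₀ A : ℝ} (ha₀8 : a₀ ≤ 8) (ha₀ : ∀ j ∈ Finset.range (m + 1), a₀ * ((L : ℝ) ^ j) ^ d ≤ a₁ j * η ^ 2 * ((L : ℝ) ^ j) ^ 2)
    (haA : ∀ j ∈ Finset.range (m + 1), a₁ j * η ^ 2 * ((L : ℝ) ^ j) ^ 2 ≤ A * ((L : ℝ) ^ j) ^ d)
    {α₀ : ℝ} (hα : 0 < α₀) (hα3 : C0 d * α₀ ≤ 1 / 3) (hα2 : 2 * α₀ ≤ c2' d L)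
    (f : suppSub (𝔸 := 𝔸) (cubeMember_Ω0_finite i hΩ).toFinset) :
    (a₀ / 2 - (2 * Cu * Cl) ^ 2 * (A * d ^ 2 * (L : ℝ) ^ 2 * (256 * (d + 1) * (d + 4) * α₀) ^ 2)) *
        formE τ (cubeMember_Ω0_finite i hΩ).toFinset f f ≤
      formE τ (cubeMember_Ω0_finite i hΩ).toFinset f
        (deltaPrimeADom L (1 : Site d → Fin d → 𝔸ˣ) η τ hτp m a₁ (fun j => (cubeLamS_finite L a Mc ρ i.k m j).toFinset)
          (cubeMember_Ω0_finite i hΩ).toFinset f) := by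
  have hone : ∀ (x : Site d) (κ' : Fin d), (1 : Site d → Fin d → 𝔸ˣ) x κ' ∈ unitaryUnits 𝔸 := fun _ _ => (unitaryUnits 𝔸).one_mem
  have hR : ∀ (x : Site d) (μ : Fin d), ‖(((1 : Site d → Fin d → 𝔸ˣ) x μ : 𝔸ˣ) : 𝔸) - 1‖ ≤ 0 * η := by
    intro x μ
    simp
  have hpdev : pdev (1 : Site d → Fin d → 𝔸ˣ) < α₀ * (((L : ℝ) ^ i.k)⁻¹) ^ 2 := by
    have h0 : pdev (1 : Site d → Fin d → 𝔸ˣ) = 0 := by unfold pdev; simp [B8Ineq130.hol_one]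
    rw [h0]
    have hL0 : (0 : ℝ) < (L : ℝ) := by exact_mod_cast (lt_of_lt_of_le (by norm_num) hL)
    positivity
  have h := coercive_near_flat_cubeMember_of_class τ hτp hτt hτs hCu hCl hCu0 hCl0 hL hη ha i hΩ hρ hm hkη hηL ha₀8 ha₀ haA hone le_rfl hR
    hα hα3 hα2 hpdev f
  have he : a₀ / 2 - (2 * Cu * Cl) ^ 2 * (d * (0 : ℝ) ^ 2 + A * d ^ 2 * (L : ℝ) ^ 2 * (256 * (d + 1) * (d + 4) * α₀ + 0) ^ 2) =
      a₀ / 2 - (2 * Cu * Cl) ^ 2 * (A * d ^ 2 * (L : ℝ) ^ 2 * (256 * (d + 1) * (d + 4) * α₀) ^ 2) := by ring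
  rw [he] at h
  exact h

include hτt hτs in
/-- ★★★ **THE LEVEL-MASS (WEIGHTED) EDITION — NEAR-FLAT TRANSFER OF ANY WEIGHTED FLAT COERCIVITY, ON THE CLASS, AT EVERY CUBE MEMBER**: if at the FLAT background
`Σ_{z∈□₀} M(z)|g(z)|²_τ ≤ ⟨g, □₀Δ′_a(1)□₀ g⟩_τ` for all `g ∈ L²(□₀,·)` with site masses `M(z) ≥ M₀ > 0` on `□₀` (e.g. print's level masses
`min{8(ηL^{j(z)})⁻², a_{j(z)}(Lᵈ)^{−j(z)}}` of [Balaban1984PropagatorsII] (2.27)), then for every unitary `U₀` of the bond-small, plaquette-small class of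
`coercive_near_flat_cubeMember_of_class` (same hypotheses, minus the flat-mass ones `a₀ ≤ 8`, `a₀(Lʲ)ᵈ ≤ a_jη²(Lʲ)²`):
`(1∕2 − (2C_uC_l)²(dθ′² + Ad²L²(256(d+1)(d+4)α₀ + θ′)²)∕M₀)·Σ_{z∈□₀} M(z)|f(z)|²_τ ≤ ⟨f, □₀Δ′_a(U₀)□₀ f⟩_τ` — the near-flat form comparison
`⟨f,Δ′(1)f⟩ ≤ 2⟨f,Δ′(U₀)f⟩ + 2(dθ² + κ)⟨f,f⟩` of `B9Eq324NearFlatFormComparisonZdTowerPairs` with the class's SCALE-FREE `θ, κ` (`B9Thm31NearFlatTransportersZd`), and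
`⟨f,f⟩ ≤ M₀⁻¹Σ M|f|²`. With level masses this is the `hco` of dag-n06-w2's Agmon road (`B9Thm31GpAgmonDecayZd`) with an `η`-free window constant.
[cite: Balaban1985BackgroundPropagators, Thm 3.1 p.397, Thm 3.11 p.416, (3.23)–(3.24) p.394; Balaban1984PropagatorsII, (2.22) p.226, (2.27) p.227; Balaban1985Averaging, Prop. 2 (52)–(54) p.26; Balaban1985RegularSpaces, (1.131) p.99] -/
theorem weighted_coercive_near_flat_cubeMember_of_class {Cu Cl : ℝ} (hCu : ∀ a : 𝔸, fnorm τ a ≤ Cu * ‖a‖) (hCl : ∀ a : 𝔸, ‖a‖ ≤ Cl * fnorm τ a)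
    (hCu0 : 0 ≤ Cu) (hCl0 : 0 ≤ Cl) (hL : 2 ≤ L) (hη : 0 < η) {a₁ : ℕ → ℝ} (ha : ∀ j, 0 ≤ a₁ j)
    (i : ZdIdx d L) {a : Site d} {Mc ρ : ℕ} (hΩ : i.Ω = cubeFam false L a Mc ρ i.k) (hρ : L ≤ ρ) {m : ℕ} (hm : m ≤ i.k)
    (hkη : ((L : ℝ) ^ i.k)⁻¹ ≤ η) (hηL : ∀ j ∈ Finset.range (m + 1), η * (L : ℝ) ^ j ≤ 1)
    {A : ℝ} (haA : ∀ j ∈ Finset.range (m + 1), a₁ j * η ^ 2 * ((L : ℝ) ^ j) ^ 2 ≤ A * ((L : ℝ) ^ j) ^ d)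
    (hU : ∀ (x : Site d) (κ' : Fin d), U₀ x κ' ∈ unitaryUnits 𝔸)
    {θ' : ℝ} (hθ' : 0 ≤ θ') (hR : ∀ (x : Site d) (μ : Fin d), ‖((U₀ x μ : 𝔸ˣ) : 𝔸) - 1‖ ≤ θ' * η)
    {α₀ : ℝ} (hα : 0 < α₀) (hα3 : C0 d * α₀ ≤ 1 / 3) (hα2 : 2 * α₀ ≤ c2' d L) (h52 : pdev U₀ < α₀ * (((L : ℝ) ^ i.k)⁻¹) ^ 2)
    {M : Site d → ℝ} {M₀ : ℝ} (hM₀ : 0 < M₀) (hM : ∀ z ∈ (cubeMember_Ω0_finite i hΩ).toFinset, M₀ ≤ M z)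
    (hflat : ∀ g : suppSub (𝔸 := 𝔸) (cubeMember_Ω0_finite i hΩ).toFinset,
      ∑ z ∈ (cubeMember_Ω0_finite i hΩ).toFinset, M z * fnorm τ ((g : Site d → 𝔸) z) ^ 2 ≤
        formE τ (cubeMember_Ω0_finite i hΩ).toFinset g
          (deltaPrimeADom L (1 : Site d → Fin d → 𝔸ˣ) η τ hτp m a₁ (fun j => (cubeLamS_finite L a Mc ρ i.k m j).toFinset)
            (cubeMember_Ω0_finite i hΩ).toFinset g))
    (f : suppSub (𝔸 := 𝔸) (cubeMember_Ω0_finite i hΩ).toFinset) :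
    (1 / 2 - (2 * Cu * Cl) ^ 2 * (d * θ' ^ 2 + A * d ^ 2 * (L : ℝ) ^ 2 * (256 * (d + 1) * (d + 4) * α₀ + θ') ^ 2) / M₀) *
        ∑ z ∈ (cubeMember_Ω0_finite i hΩ).toFinset, M z * fnorm τ ((f : Site d → 𝔸) z) ^ 2 ≤
      formE τ (cubeMember_Ω0_finite i hΩ).toFinset f
        (deltaPrimeADom L U₀ η τ hτp m a₁ (fun j => (cubeLamS_finite L a Mc ρ i.k m j).toFinset) (cubeMember_Ω0_finite i hΩ).toFinset f) := by
  have hδ0 : 0 ≤ θ' * η := mul_nonneg hθ' hη.le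
  -- the tower transporters of the class: unitary, and `ε′_i`-close to `1` on the tower pairs (operator norm)
  have hT : ∀ i', i' < m → ∀ z y : Site d, B8Eq119TwistedAxial.bgT L U₀ i' z y ∈ unitaryUnits 𝔸 :=
    fun i' hi' z y => bgT_mem_unitaryUnits_of_pdev hL i.k hU hα hα3 hα2 h52 (by omega) z y
  have hTε : ∀ i', i' < m → ∀ (w : Site d),
      ‖((B8Eq119TwistedAxial.bgT L U₀ i' (Literature.MathematicalPhysics.QuantumLattice.blockMap L w) w : 𝔸ˣ) : 𝔸) - 1‖ ≤
        d * L * (256 * (d + 1) * (d + 4) * α₀ * ((L : ℝ) ^ i' * ((L : ℝ) ^ i.k)⁻¹) ^ 2 + (L : ℝ) ^ i' * (θ' * η)) :=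
    fun i' hi' w => norm_bgT_pair_sub_one_le hL i.k hU hα hα3 hα2 h52 hδ0 hR (by omega) w
  have hε' : ∀ i' : ℕ, 0 ≤ d * L * (256 * (d + 1) * (d + 4) * α₀ * ((L : ℝ) ^ i' * ((L : ℝ) ^ i.k)⁻¹) ^ 2 + (L : ℝ) ^ i' * (θ' * η)) :=
    fun i' => by positivity
  have hA : 0 ≤ A := by
    -- from the upper weight bound at `j = 0`: `0 ≤ a₀·η²·1 ≤ A·1`
    have h0 : (0 : ℕ) ∈ Finset.range (m + 1) := Finset.mem_range.2 (Nat.succ_pos m)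
    have h2 := haA 0 h0
    have h3 : 0 ≤ a₁ 0 * η ^ 2 * ((L : ℝ) ^ 0) ^ 2 := mul_nonneg (mul_nonneg (ha 0) (sq_nonneg η)) (sq_nonneg _)
    rw [pow_zero, one_pow, mul_one, one_pow, mul_one] at h2
    rw [pow_zero, one_pow, mul_one] at h3
    exact h3.trans h2
  have hκ0 : 0 ≤ A * d ^ 2 * (L : ℝ) ^ 2 * (256 * (d + 1) * (d + 4) * α₀ + θ') ^ 2 := by positivity
  -- the τ-size readings with `θ := Cθ′`, `ε := Cε′`, `κ := C²κ′`, `C = 2C_uC_l`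
  set C : ℝ := 2 * Cu * Cl with hC
  have hC0 : 0 ≤ C := by positivity
  have hRτ : ∀ (x : Site d) (μ : Fin d) (b : 𝔸), fnorm τ (B7Eq78Linearization.conjR (U₀ x μ) b - b) ≤ (C * θ') * η * fnorm τ b := by
    intro x μ b
    refine (fnorm_conjR_sub_le_of_cmp τ hCu hCl hCu0 (hU x μ) b).trans ?_
    rw [← hC]
    have hb := B9Eq342CombesThomasFormZd.fnorm_nonneg τ b
    calc C * ‖((U₀ x μ : 𝔸ˣ) : 𝔸) - 1‖ * fnorm τ b ≤ C * (θ' * η) * fnorm τ b :=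
          mul_le_mul_of_nonneg_right (mul_le_mul_of_nonneg_left (hR x μ) hC0) hb
      _ = (C * θ') * η * fnorm τ b := by ring
  have hTτ : ∀ i', i' < m → ∀ (w : Site d) (b : 𝔸),
      fnorm τ (B7Eq78Linearization.conjR (B8Eq119TwistedAxial.bgT L U₀ i' (Literature.MathematicalPhysics.QuantumLattice.blockMap L w) w) b - b) ≤
        (C * (d * L * (256 * (d + 1) * (d + 4) * α₀ * ((L : ℝ) ^ i' * ((L : ℝ) ^ i.k)⁻¹) ^ 2 + (L : ℝ) ^ i' * (θ' * η)))) * fnorm τ b := by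
    intro i' hi' w b
    refine (fnorm_conjR_sub_le_of_cmp τ hCu hCl hCu0 (hT i' hi' _ _) b).trans ?_
    rw [← hC]
    exact mul_le_mul_of_nonneg_right (mul_le_mul_of_nonneg_left (hTε i' hi' w) hC0) (B9Eq342CombesThomasFormZd.fnorm_nonneg τ b)
  have hκτ : ∀ j ∈ Finset.range (m + 1), a₁ j * ((((L : ℝ) ^ d) ^ j)⁻¹ *
      (∑ i' ∈ Finset.range j, C * (d * L * (256 * (d + 1) * (d + 4) * α₀ * ((L : ℝ) ^ i' * ((L : ℝ) ^ i.k)⁻¹) ^ 2 + (L : ℝ) ^ i' * (θ' * η)))) ^ 2) ≤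
      C ^ 2 * (A * d ^ 2 * (L : ℝ) ^ 2 * (256 * (d + 1) * (d + 4) * α₀ + θ') ^ 2) := by
    intro j hj
    rw [← Finset.mul_sum, mul_pow]
    have hw := sum_eps_sq_weight_le hL hη hkη hηL hθ' hα.le ha haA hj
    calc a₁ j * ((((L : ℝ) ^ d) ^ j)⁻¹ * (C ^ 2 *
          (∑ i' ∈ Finset.range j, d * L * (256 * (d + 1) * (d + 4) * α₀ * ((L : ℝ) ^ i' * ((L : ℝ) ^ i.k)⁻¹) ^ 2 + (L : ℝ) ^ i' * (θ' * η))) ^ 2))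
        = C ^ 2 * (a₁ j * ((((L : ℝ) ^ d) ^ j)⁻¹ *
          (∑ i' ∈ Finset.range j, d * L * (256 * (d + 1) * (d + 4) * α₀ * ((L : ℝ) ^ i' * ((L : ℝ) ^ i.k)⁻¹) ^ 2 + (L : ℝ) ^ i' * (θ' * η))) ^ 2)) := by
          ring
      _ ≤ C ^ 2 * (A * d ^ 2 * (L : ℝ) ^ 2 * (256 * (d + 1) * (d + 4) * α₀ + θ') ^ 2) := mul_le_mul_of_nonneg_left hw (sq_nonneg C)
  -- the near-flat form comparison on the tower pairs of the cube member
  have h2 := formE_deltaPrimeADom_one_le_near_flat' τ hτp hτt hτs hη hU hRτ m ha _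
    (fun j hj y hy => ((B9Eq319QQStarDiagonalZd.fullBlockGeometry_cubeMember i hΩ hρ hm) j hj y hy).2)
    (fun i' => mul_nonneg hC0 (hε' i')) hT hTτ (by positivity) hκτ f
  have h1 := hflat f
  -- `M₀⟨f,f⟩ ≤ Σ M|f|²`
  have hFS : M₀ * formE τ (cubeMember_Ω0_finite i hΩ).toFinset f f ≤
      ∑ z ∈ (cubeMember_Ω0_finite i hΩ).toFinset, M z * fnorm τ ((f : Site d → 𝔸) z) ^ 2 := by
    rw [B9Eq342CombesThomasFormZd.formE_self_eq_sum_sq hτp f, Finset.mul_sum]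
    exact Finset.sum_le_sum fun z hz => mul_le_mul_of_nonneg_right (hM z hz) (sq_nonneg _)
  have hK0 : 0 ≤ d * (C * θ') ^ 2 + C ^ 2 * (A * d ^ 2 * (L : ℝ) ^ 2 * (256 * (d + 1) * (d + 4) * α₀ + θ') ^ 2) := by positivity
  have hKF : (d * (C * θ') ^ 2 + C ^ 2 * (A * d ^ 2 * (L : ℝ) ^ 2 * (256 * (d + 1) * (d + 4) * α₀ + θ') ^ 2)) *
        formE τ (cubeMember_Ω0_finite i hΩ).toFinset f f ≤
      (d * (C * θ') ^ 2 + C ^ 2 * (A * d ^ 2 * (L : ℝ) ^ 2 * (256 * (d + 1) * (d + 4) * α₀ + θ') ^ 2)) *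
        ((∑ z ∈ (cubeMember_Ω0_finite i hΩ).toFinset, M z * fnorm τ ((f : Site d → 𝔸) z) ^ 2) / M₀) := by
    refine mul_le_mul_of_nonneg_left ?_ hK0
    rw [le_div_iff₀ hM₀, mul_comm]
    exact hFS
  have he : (1 / 2 - (2 * Cu * Cl) ^ 2 * (d * θ' ^ 2 + A * d ^ 2 * (L : ℝ) ^ 2 * (256 * (d + 1) * (d + 4) * α₀ + θ') ^ 2) / M₀) *
        ∑ z ∈ (cubeMember_Ω0_finite i hΩ).toFinset, M z * fnorm τ ((f : Site d → 𝔸) z) ^ 2 =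
      (∑ z ∈ (cubeMember_Ω0_finite i hΩ).toFinset, M z * fnorm τ ((f : Site d → 𝔸) z) ^ 2) / 2 -
        (d * (C * θ') ^ 2 + C ^ 2 * (A * d ^ 2 * (L : ℝ) ^ 2 * (256 * (d + 1) * (d + 4) * α₀ + θ') ^ 2)) *
          ((∑ z ∈ (cubeMember_Ω0_finite i hΩ).toFinset, M z * fnorm τ ((f : Site d → 𝔸) z) ^ 2) / M₀) := by
    rw [hC]; ring
  rw [he]
  linarith [h1, h2, hKF]

end Literature.MathematicalPhysics.QuantumFieldTheory.Balaban1983to89.B9Thm31NearFlatCoerciveClassZd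

end
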